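import Summits.AtomisticToContinuum.BoseEinsteinCondensation.Theorems.BECGroundStateSOSPeriodicIRBoundZeroMomentumGapBounded
import Summits.AtomisticToContinuum.BoseEinsteinCondensation.Theorems.BECGroundStateSOSPeriodicIRBoundPFFormUpperBound2
import Summits.AtomisticToContinuum.BoseEinsteinCondensation.Theorems.BECGroundStateSOSPeriodicIRBoundPFPositiveMain
import Summits.AtomisticToContinuum.BoseEinsteinCondensation.Theorems.BECGroundStateSOSPeriodicIRBoundPFTwoMinimisers
import Summits.AtomisticToContinuum.BoseEinsteinCondensation.Theorems.BECGroundStateSOSPeriodicIRBoundPFMinimiserUnique2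
import HarnessLib

/-!
# Crux `PeriodicIRBound` (stmt-AtomisticToContinuum-3972), line `linear-ph-floor-wagner` —
# stub 3b′ CLOSED: Perron–Frobenius nondegeneracy of the periodic `N`-boson ground state for finite-range
# INTEGRABLE (possibly unbounded) pair potentials, and the zero-momentum gap at fixed `(N, L)`

Helper file of the line lead (seat c2) for the crux skeleton `Cruxes/PeriodicIRBound/Lines/linear_ph_floor_wagner.lean`
(v12). It composes the four registered stubs of the v11 reshape — S-A `stub_fkFormUpperBoundIntegrable` (small-time form
upper bound of the torus Feynman–Kac pairing, `…PFFormUpperBound*.lean`), S-B `stub_fkPositiveOfMinimiser` (nonnegative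
maximal-form minimisers are a.e. strictly positive, `…PFOpNorm/PFJensen/PFPositive/PFPositiveMain.lean`), S-C1
`stub_twoMinimisersOfDegenerate` (`kyFanTwo ≤ 2E₀` forces two orthonormal Bose minimisers, `…PFTwoMinimisers.lean`), S-C2
`stub_minimiserUniqueOfPositive` (uniqueness of minimisers up to phase from positivity, `…PFMinimiserUnique*.lean`) — into

* `two_mul_periodicGroundStateEnergy_lt_kyFanTwo` — **`2·E₀^per(N,L) < kyFanTwo v N L`** for `N ≥ 1`, `L > 0` and every
  repulsive finite-range `v` with `∫ v(|x|)dx < ∞` (the finite-range case of the Literature fact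
  `PeriodicGroundStateNondegenerateIntegrable`, Reed–Simon IV Thm XIII.48(a) = Faris–Simon 1975, here PROVED in the tree:
  Feynman–Kac + truncation + Beurling–Deny, no operator theory for the unbounded `H_v`);
* `zeroMomentumGapFor_of_integrable` — the zero-momentum gap `E₀^per(N,L) < E^per_N(q;L)` (`q ≠ 0`) for every such `v`
  (seat c1's Bloch-conjugation lemma `zeroMomentumGap_of_two_mul_lt_kyFanTwo`; `N = 0`: empty sector);
* `stub_zeroMomentumGroundUnbounded` — the registered stub 3b′ of the skeleton, verbatim, now UNCONDITIONAL;
* `zeroMomentumGround_holds` — the pooled sibling item stmt-AtomisticToContinuum-11845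
  (`BECNoCheapMomentum.ZeroMomentumGround`) in full.

References: Reed–Simon IV §XIII.12 Thms XIII.43–XIII.48; Faris–Simon, Duke Math. J. 42 (1975) 559; B. Simon,
J. Operator Theory 1 (1979) 37; Cornean–Dereziński–Ziń, J. Math. Phys. 50 (2009) 062103 §2.7.
-/

noncomputable section

open scoped BigOperators ENNReal NNReal InnerProductSpace
open Filter MeasureTheory UnitAddTorus

namespace Summit.AtomisticToContinuum.BoseEinsteinCondensation.Cruxes.PeriodicIRBound.LinearPhFloorWagner

open Literature.MathematicalPhysics.QuantumManyBody
open Literature.MathematicalPhysics.QuantumManyBody.BoseGas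
open Summit.AtomisticToContinuum.BoseEinsteinCondensation.Theses.BECNoCheapMomentum (ZeroMomentumGround)
open Summit.AtomisticToContinuum.BoseEinsteinCondensation.Theorems.PeriodicIRBound.Negative
  (momentumSectorEnergy_zero_particles)

-- The measure on `ℝ/ℤ` is the Haar PROBABILITY measure, as in `PeriodicFormDomain.lean` (the stubs S-C1/S-C2 speak
-- about the maximal form on `L²((ℝ/ℤ)^{3N})`).
attribute [local instance] Literature.MathematicalPhysics.QuantumManyBody.BoseGas.formDomain_measureSpace
  Literature.MathematicalPhysics.QuantumManyBody.BoseGas.formDomain_isProbabilityMeasure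
  Literature.MathematicalPhysics.QuantumManyBody.BoseGas.formDomain_isProbabilityMeasure_pi

/-- **Nondegeneracy of the periodic `N`-boson ground state for finite-range INTEGRABLE pair potentials**
(`2·E₀ < kyFanTwo`, `N ≥ 1`, `L > 0`; `v^per` possibly unbounded): if `kyFanTwo ≤ 2E₀`, S-C1 gives two
orthonormal Bose maximal-form minimisers, contradicting S-C2 fed with the positivity KEY S-B (itself fed with the
form upper bound S-A). The finite-range case of `PeriodicGroundStateNondegenerateIntegrable`.
[cite: ReedSimonIV1978, §XIII.12 Thm XIII.48(a)] -/
theorem two_mul_periodicGroundStateEnergy_lt_kyFanTwo {N : ℕ} (hN : 1 ≤ N) {L : ℝ} (hL : 0 < L)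
    {v : ℝ → ℝ≥0∞} (hv : IsRepulsiveFiniteRange v) (hint : (∫⁻ x : Space, v ‖x‖) ≠ ⊤) :
    2 * periodicGroundStateEnergy v N L < kyFanTwo v N L := by
  by_contra hge
  rw [not_lt] at hge
  have hW : ∫⁻ X in cellN N L, periodicInteraction v L X ≠ ⊤ :=
    WF.lintegral_cellN_periodicInteraction_ne_top hL hv.1 hint N
  obtain ⟨η₁, η₂, h1, h2, horth, hs1, hs2, hQ1, hQ2⟩ := stub_twoMinimisersOfDegenerate hN hL hv.1 hW hge
  exact stub_minimiserUniqueOfPositive (stub_fkPositiveOfMinimiser stub_fkFormUpperBoundIntegrable)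
    hN hL hv hint η₁ η₂ h1 h2 hs1 hs2 hQ1 hQ2 horth

/-- **Zero-momentum gap at fixed `(N, L)` for every finite-range integrable pair potential**: `E₀^per(N,L) <
E^per_N(q;L)` for `q ≠ 0` (`N ≥ 1`: nondegeneracy and cell-orthogonality of a Bloch-`q` state and its conjugate,
`zeroMomentumGap_of_two_mul_lt_kyFanTwo`; `N = 0`: the sector is empty). [cite: ReedSimonIV1978, §XIII.12 Thm XIII.48(a)] -/
theorem zeroMomentumGapFor_of_integrable {v : ℝ → ℝ≥0∞} (hv : IsRepulsiveFiniteRange v)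
    (hint : (∫⁻ x : Space, v ‖x‖) ≠ ⊤) : ZeroMomentumGapFor v := by
  intro N L hL q hq
  rcases Nat.eq_zero_or_pos N with rfl | hN
  · rw [momentumSectorEnergy_zero_particles v L hq, periodicGroundStateEnergy_zero_particles v hL]
    exact ENNReal.zero_lt_top
  · exact zeroMomentumGap_of_two_mul_lt_kyFanTwo hL (two_mul_periodicGroundStateEnergy_lt_kyFanTwo hN hL hv hint) hq

/-- **Registered stub 3b′ `stub_zeroMomentumGroundUnbounded` of the crux skeleton (line `linear-ph-floor-wagner`),
verbatim signature, UNCONDITIONAL**: the zero-momentum gap for every integrable admissible `v` that is not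
essentially bounded (the essential-unboundedness hypothesis is idle — the integrable case is uniform).
[cite: ReedSimonIV1978, §XIII.12 Thm XIII.48(a)] -/
theorem stub_zeroMomentumGroundUnbounded :
    ∀ v : ℝ → ℝ≥0∞, IsRepulsiveFiniteRange v → (∫⁻ x : Space, v ‖x‖) ≠ ⊤ →
      (¬ ∃ M : ℝ≥0∞, M ≠ ⊤ ∧ ∀ᵐ x : Space, v ‖x‖ ≤ M) → ZeroMomentumGapFor v :=
  fun _ hv hint _ => zeroMomentumGapFor_of_integrable hv hint

/-- **The pooled sibling item stmt-AtomisticToContinuum-11845 (`BECNoCheapMomentum.ZeroMomentumGround`), in full**: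
for every repulsive finite-range `v` with `∫ v(|x|)dx < ∞`, every `N`, `L > 0`, `q ≠ 0`:
`E₀^per(N,L) < E^per_N(q;L)`. [cite: ReedSimonIV1978, §XIII.12 Thm XIII.48(a)] -/
theorem zeroMomentumGround_holds : ZeroMomentumGround :=
  zeroMomentumGround_iff.2 fun _ hv hint => zeroMomentumGapFor_of_integrable hv hint

/-- The finite-range case of the Literature fact `PeriodicGroundStateNondegenerateIntegrable`, in its quantifier shape.
[cite: ReedSimonIV1978, §XIII.12 Thm XIII.48(a)] -/
theorem periodicGroundStateNondegenerateIntegrable_of_finiteRange :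
    ∀ (N : ℕ) (L : ℝ) (v : ℝ → ℝ≥0∞), 1 ≤ N → 0 < L → IsRepulsiveFiniteRange v →
      (∫⁻ x : Space, v ‖x‖) ≠ ⊤ → 2 * periodicGroundStateEnergy v N L < kyFanTwo v N L :=
  fun _ _ _ hN hL hv hint => two_mul_periodicGroundStateEnergy_lt_kyFanTwo hN hL hv hint

end Summit.AtomisticToContinuum.BoseEinsteinCondensation.Cruxes.PeriodicIRBound.LinearPhFloorWagner

end
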